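import Mathlib
import HarnessLib
import Summits.HubbardSuperconductivity.HubbardSuperconductivity.Theorems.KLProgrammeKLRegimeTwoVolumeTowerDataTSOfLawsH0
import Summits.HubbardSuperconductivity.HubbardSuperconductivity.Theorems.KLProgrammeKLRegimeTwoVolumeTowerVolumeDataTSOfReadout
import Summits.HubbardSuperconductivity.HubbardSuperconductivity.Theorems.KLProgrammeKLRegimeTwoVolumeTowerBudgetLaws

/-!
# Route `KLProgramme` — crux K3, VL child `KLRegimeVolumeLimitV17F2` (stmt-HubbardSuperconductivity-20440), skeleton «cauchy» v11: THE SOURCE-RESCALED DATA PACKAGE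
# FROM THE SUPPLIERS' READ-OUTS WITH THE BASE (H6) AS A HYPOTHESIS (twin of `…TowerDataTSOfReadouts.towerDataTS_of_readouts`; seat hubbard-kl-k3c4-p1 g16; `--supports` 20440)

Byte-identical to `towerDataTS_of_readouts` (p636973) except that the base-transfer bundle `hdataT`, its scalars and the grid-data block are replaced by the ONE
base hypothesis `h0T` (located «BASE-SRC-ROWS»), threaded to `towerDataTS_of_lawsH0`.

* **`towerDataTS_of_readoutsH0`**.

Proofs only; no definition.  Honest framing: a conditional constructor; nothing here asserts `h0T`, the read-outs, any stub, K3, VL or superconductivity.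
[cite: BenfattoGiulianiMastropietro2006, §2.7-§2.9 and §3]
-/

noncomputable section

namespace Summit.HubbardSuperconductivity.HubbardSuperconductivity.Theorems.TwoVolumeSource

set_option linter.dupNamespace false -- summit = problem name (single-conjunct summit), D-0017

open Finset Filter Topology Literature.MathematicalPhysics.QuantumLattice GrassmannAlgebra Literature.Probability.LatticeModels
  Literature.Probability.LatticeModels.BattleFederbush
open Summit.HubbardSuperconductivity.HubbardSuperconductivity.Theorems.KLRegimeSplit
open Summit.HubbardSuperconductivity.HubbardSuperconductivity.Theorems.KLProgrammeLegKernels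
open Summit.HubbardSuperconductivity.HubbardSuperconductivity.Theorems.TwoPointAssembly
open Summit.HubbardSuperconductivity.HubbardSuperconductivity.Theorems.EngineV8
open Summit.HubbardSuperconductivity.HubbardSuperconductivity.Theorems.TwoVolumeDefect

set_option maxHeartbeats 1600000 in -- one large constructor application plus the budget bookkeeping
/-- **`TowerDataTS β U μ t` FROM THE SUPPLIERS' READ-OUTS** (see the module docstring). [folklore: composition; cite: BenfattoGiulianiMastropietro2006, §2.7-§2.9 and §3] -/
theorem towerDataTS_of_readoutsH0 (β U μ : ℝ) (hβ : 0 < β) (P : SplitConsts) (Q Q' : EngConsts) (hCE : 0 ≤ Q.CE) (hCE' : 0 ≤ Q'.CE) (hKl : 0 ≤ P.Klam)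
    (A : ℕ → ℕ → ℝ) (hA : ∀ j s, 0 ≤ A j s) {t : ℝ} (ht0 : 0 < t) (ht1 : t ≤ 1)
    (hτ : ∀ j, j ≤ nScales β → ∀ m : ℕ, t * klSrcBudget P Q' U A (j + 1) 1 m + t ^ 2 * klSrcBudget P Q' U A (j + 1) 2 m ≤
      klWtBudget P Q U (j + 1) 2 * (if m ≤ 2 then 1 else klWtBudget P Q' U (j + 1) m))
    (Mth : ℕ → ℕ → ℕ)
    -- constants and laws
    (Λ ΛT κ κf aW sW eW' cW cRb cCb δb : ℕ → ℝ) (sE cR cC δ : ℕ → ℕ → ℝ) (r : ℕ → ℕ) (k₀ a₀ cR₀ cC₀ kf cW₀ δb₀ r₀ C₀ εb : ℝ)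
    (hΛ : ∀ j, 0 < Λ j) (hΛmono : ∀ j, Λ (j + 1) ≤ Λ j) (hΛT : ∀ j, Λ j ≤ ΛT j) (hΛr : ∀ j, j ≤ nScales β → Λ j ≤ klScale klE0 (r j))
    (hk₀ : 0 < k₀) (hκ : ∀ j, 0 < κ j) (hκ2 : ∀ j, κ j ^ 2 = k₀ ^ 2 * ((8 : ℝ) ^ j)⁻¹) (hκfge : ∀ j, κ j ≤ κf j) (hκf : ∀ j, κf j ≤ kf * κ j)
    (hkf : 1 ≤ kf) (haW0 : ∀ j, 0 ≤ aW j) (haW : ∀ j, aW j ≤ a₀ * 4 ^ j) (hsW : ∀ j, 0 ≤ sW j) (heW' : ∀ j, 0 ≤ eW' j)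
    (hcW1 : ∀ j, 1 ≤ cW j) (hcW : ∀ j, cW j ≤ cW₀) (hcRb0 : ∀ j, 0 ≤ cRb j) (hcRb : ∀ j, cRb j ≤ cR₀) (hcCb0 : ∀ j, 0 ≤ cCb j) (hcCb : ∀ j, cCb j ≤ cC₀)
    (hδb0 : ∀ j, 0 ≤ δb j) (hδb : ∀ j, δb j ≤ δb₀) (hr₀0 : 0 ≤ r₀) (hr₀ : 8 * Real.exp 2 * (kf + 1) * (cW₀ + δb₀ + 1) ≤ r₀) (hC₀ : 0 ≤ C₀)
    -- E1's alive budgets with their law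
    (S₀ : ℕ → ℕ → ℝ) (hS₀0 : ∀ j m, 0 ≤ S₀ j m) (hS₀law : ∀ j, j ≤ nScales β → ∀ m, 1 ≤ m → S₀ j (2 * m) ≤ C₀ * klWtBudget P Q U (j + 1) (2 * m))
    -- the four scale-free inequalities on `ε_{j+1}`, `j ≤ n_β`
    (hε : ∀ j, j ≤ nScales β → 0 < epsCoupling P U (j + 1)) (hεb : ∀ j, j ≤ nScales β → epsCoupling P U (j + 1) ≤ εb)
    (hεq : ∀ j, j ≤ nScales β → 8 * Q.CE * (2 * Real.exp 2 ^ 2 * (1 + r₀) ^ 2 * k₀ ^ 2) * epsCoupling P U (j + 1) ≤ 1)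
    (hεq' : ∀ j, j ≤ nScales β → 8 * Q'.CE * (2 * Real.exp 2 ^ 2 * (1 + r₀) ^ 2 * k₀ ^ 2) * epsCoupling P U (j + 1) ≤ 1)
    (hsmall : ∀ j, j < nScales β → epsCoupling P U (j + 1) *
      (256 * Real.exp 1 ^ 2 * (a₀ + cR₀ + cC₀ + 1) * (42 * cW₀ + 4 * δb₀ + 8 * Real.exp 1) *
        (Q.CE * (2 * Real.exp 2 ^ 2 * (1 + r₀) ^ 2 * k₀ ^ 2) / 4 *
          (C₀ * (1 + 8 * Q.CE * (2 * Real.exp 2 ^ 2 * (1 + r₀) ^ 2 * k₀ ^ 2)) + 1 +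
            εb * Q'.CE * (1 + 8 * Q'.CE * (2 * Real.exp 2 ^ 2 * (1 + r₀) ^ 2 * k₀ ^ 2)) / 4))) ≤ k₀ ^ 2)
    -- (H4) the mismatch rates
    (hmis : ∀ j L, 0 ≤ sE j L ∧ 0 ≤ cR j L ∧ 0 ≤ cC j L ∧ 0 ≤ δ j L ∧ cR j L ≤ cRb j ∧ cC j L ≤ cCb j ∧ δ j L ≤ δb j)
    (hmis0 : ∀ j, Tendsto (sE j) atTop (𝓝 0) ∧ Tendsto (cR j) atTop (𝓝 0) ∧ Tendsto (cC j) atTop (𝓝 0) ∧ Tendsto (δ j) atTop (𝓝 0))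
    -- (H5) the suppliers' conclusions at every admissible instance, eventually in `L`
    (hinst : ∀ᶠ L in atTop, ∀ (b M : ℕ) [NeZero L] [NeZero (b * L)] [NeZero M], Mth L b ≤ M →
      (∀ k, k ≤ nScales β → hubbardEffPartitionFnCT L M β U μ 0 (klFlowFrameU L M β U μ (nScales β + 1)) (klScale klE0 (k + 1)) ≠ 0) ∧
      (∀ k, k ≤ nScales β → hubbardEffPartitionFnCT (b * L) M β U μ 0 (klFlowFrameU (b * L) M β U μ (nScales β + 1)) (klScale klE0 (k + 1)) ≠ 0) ∧
      (∀ j, j < nScales β → ScaleCovData (klStepCov L M β μ (klFlowFrameU L M β U μ (nScales β + 1)) j) (Λ j) (κ j) (aW j / imagTimeWeight β M) (sW j)) ∧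
      (∀ j, j < nScales β →
        ScaleCovData (klStepCov (b * L) M β μ (klFlowFrameU (b * L) M β U μ (nScales β + 1)) j) (Λ j) (κ j) (aW j / imagTimeWeight β M) (sW j)) ∧
      (∀ j, j ≤ nScales β → ∀ (m : ℕ) (q : Fin m) (w : SpaceTimeIdx L M × SectorLeg (sectorCount j)),
        klWtPinnedSumAt L M β μ (klFlowFrameU L M β U μ (nScales β + 1)) j (r j) m
          (klEffectiveAction L M β U μ (klFlowFrameU L M β U μ (nScales β + 1)) klE0 (j + 1)) q w ≤ S₀ j m) ∧
      (∀ j, j ≤ nScales β → ∀ (m : ℕ) (q : Fin m) (w : SpaceTimeIdx (b * L) M × SectorLeg (sectorCount j)),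
        klWtPinnedSumAt (b * L) M β μ (klFlowFrameU (b * L) M β U μ (nScales β + 1)) j (r j) m
          (klEffectiveAction (b * L) M β U μ (klFlowFrameU (b * L) M β U μ (nScales β + 1)) klE0 (j + 1)) q w ≤ S₀ j m) ∧
      (∀ j, j ≤ nScales β → SourceProfilesAtLev L M (klSrcBudget P Q' U A (j + 1)) β U μ (klFlowFrameU L M β U μ (nScales β + 1)) j (r j) (j + 1)) ∧
      (∀ j, j ≤ nScales β →
        SourceProfilesAtLev (b * L) M (klSrcBudget P Q' U A (j + 1)) β U μ (klFlowFrameU (b * L) M β U μ (nScales β + 1)) j (r j) (j + 1)) ∧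
      TowerCrossData L b M β μ (klFlowFrameU L M β U μ (nScales β + 1)) (klFlowFrameU (b * L) M β U μ (nScales β + 1)) (nScales β) (imagTimeWeight β M)
        Λ κ aW sW eW' ΛT cW κf (fun j => sE j L) (fun j => cR j L) (fun j => cC j L) (fun j => δ j L))
    -- (H6) the BASE as a hypothesis (located «BASE-SRC-ROWS», p3 g18: the transfer-row route to it is dead; any route may supply it): the TRUNCATED keyed
    -- defect of the step-`0` states at the `2r_L`-deep pins, canonical radius `r_L = L/(4J+7)`, tends to zero uniformly in the instance
    (h0T : ∀ (k : ℕ) (η : ℝ), 0 < η → ∀ᶠ L in atTop, ∀ (b M : ℕ) [NeZero L] [NeZero (b * L)] [NeZero M], Mth L b ≤ M →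
      ∀ (p : Fin k) (w : SrcLabel (b * L) M 0),
        (∀ i, 2 * (L / (4 * nScales β + 7)) ≤ (w.1.1.2 i).val % L ∧ (w.1.1.2 i).val % L + 2 * (L / (4 * nScales β + 7)) < L) →
        klKeyedDefectT L b M β U μ (klFlowFrameU L M β U μ (nScales β + 1)) (klFlowFrameU (b * L) M β U μ (nScales β + 1)) 0 k p w ≤ imagTimeWeight β M * η)
 :
    Nonempty (TowerDataTS β U μ t) := by
  classical
  -- §0 the top scale, the constants `Dq`, `K`, the ratio `q`, the majorant constant `Aj`, the budget `NV`
  set J := nScales β with hJ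
  have hE : 0 < Real.exp 2 := Real.exp_pos 2
  set Dq : ℝ := 2 * Real.exp 2 ^ 2 * (1 + r₀) ^ 2 * k₀ ^ 2 with hDq
  have hDq0 : 0 < Dq := by positivity
  set K : ℝ := Q.CE * Dq / 4 * (C₀ * (1 + 8 * Q.CE * Dq) + 1 + εb * Q'.CE * (1 + 8 * Q'.CE * Dq) / 4) with hK
  have hεb0 : 0 ≤ εb := (hε 0 (Nat.zero_le _)).le.trans (hεb 0 (Nat.zero_le _))
  have hK0 : 0 ≤ K := by positivity
  obtain ⟨q, hq⟩ : ∃ q : ℕ → ℝ, ∀ j, q j = (8 : ℝ) ^ j / Dq := ⟨_, fun _ => rfl⟩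
  have hq' : ∀ j, q j = 1 / (2 * (Real.exp 2 * (κ j + r₀ * κ j)) ^ 2) := fun j => by rw [hq, q_of_kappa_law hk₀ hr₀0 (hκ2 j)]
  have hq0 : ∀ j, 0 < q j := fun j => by rw [hq]; positivity
  obtain ⟨Aj, hAj⟩ : ∃ Aj : ℕ → ℝ, ∀ j, Aj j = epsCoupling P U (j + 1) * ((32 : ℝ) ^ j)⁻¹ * K := ⟨_, fun _ => rfl⟩
  have hε0 : ∀ i, 0 ≤ epsCoupling P U i := fun i => epsCoupling_nonneg' hKl U i
  have hAj0 : ∀ j, 0 ≤ Aj j := fun j => by rw [hAj]; have := hε0 (j + 1); positivity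
  obtain ⟨NV, hNV⟩ : ∃ NV : ℕ → ℕ → ℝ, ∀ j m, NV j m = if j ≤ J then (if m = 0 then 0 else
      S₀ j (2 * m) + t * klSrcBudget P Q' U A (j + 1) 1 (2 * m) + t ^ 2 * klSrcBudget P Q' U A (j + 1) 2 (2 * m)) else 0 := ⟨_, fun _ _ => rfl⟩
  have hSB : ∀ j s m, 0 ≤ klSrcBudget P Q' U A j s m := fun j s m => by
    unfold klSrcBudget
    refine mul_nonneg (hA j s) ?_
    split_ifs
    · exact zero_le_one
    · exact klWtBudget_nonneg hCE' hKl U j m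
  have hNV0 : ∀ j m, 0 ≤ NV j m := fun j m => by
    rw [hNV]
    split_ifs
    · exact le_rfl
    · exact add_nonneg (add_nonneg (hS₀0 j _) (mul_nonneg ht0.le (hSB _ _ _))) (mul_nonneg (sq_nonneg t) (hSB _ _ _))
    · exact le_rfl
  -- §1 the geometric majorant `NV j m ≤ Aj j · q j ^ m`
  have hNVle : ∀ j m, NV j m ≤ Aj j * q j ^ m := by
    intro j m
    have hR : 0 ≤ Aj j * q j ^ m := mul_nonneg (hAj0 j) (pow_nonneg (hq0 j).le m)
    rw [hNV]
    by_cases hj : j ≤ J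
    · rw [if_pos hj]
      rcases Nat.eq_zero_or_pos m with h0 | hm
      · rw [if_pos h0]; exact hR
      · rw [if_neg hm.ne']
        have hεj := hε j hj
        -- S₀ + t S₁ + t² S₂ ≤ S₀ + τ · (Q'-law)
        have h1 : S₀ j (2 * m) + t * klSrcBudget P Q' U A (j + 1) 1 (2 * m) + t ^ 2 * klSrcBudget P Q' U A (j + 1) 2 (2 * m) ≤
            S₀ j (2 * m) + klWtBudget P Q U (j + 1) 2 * (if 2 * m ≤ 2 then 1 else klWtBudget P Q' U (j + 1) (2 * m)) := by
          linarith [hτ j hj (2 * m)]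
        -- ≤ (geometric constant) · q^m
        have hqj : Q.CE * epsCoupling P U (j + 1) * 8 ^ (j + 1) ≤ q j := by
          rw [hq, le_div_iff₀ hDq0, pow_succ]
          have h := hεq j hj
          have h8 : (0 : ℝ) ≤ 8 ^ j := by positivity
          nlinarith [h, h8]
        have hqj' : Q'.CE * epsCoupling P U (j + 1) * 8 ^ (j + 1) ≤ q j := by
          rw [hq, le_div_iff₀ hDq0, pow_succ]
          have h := hεq' j hj
          have h8 : (0 : ℝ) ≤ 8 ^ j := by positivity
          nlinarith [h, h8]
        have h2 := towerBudget_le_geom P Q Q' U (j + 1) hCE hCE' hεj (hq0 j) hqj hqj' hC₀ (klWtBudget_nonneg hCE hKl U (j + 1) 2) (S₀ j)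
          (hS₀law j hj) hm
        -- the constant ≤ ε (32^j)⁻¹ K
        have h3 := towerBudgetConst_le_laws P Q Q' U j hCE hCE' hεj (hεb j hj) hDq0 (C₀ := C₀) (hq j) (klWtBudget_two_eq_inv_pow P Q U (j + 1))
        have h4 := mul_le_mul_of_nonneg_right h3 (pow_nonneg (hq0 j).le m)
        rw [hAj]
        exact h1.trans (h2.trans h4)
    · rw [if_neg hj]; exact hR
  -- §2 the two smallness inequalities
  obtain ⟨hS, hS'⟩ := towerSmallnessIneq_of_laws_lt J κ aW cRb cCb cW δb Aj (fun i => epsCoupling P U i) hκ2 haW0 haW hcRb0 hcRb hcCb0 hcCb hcW1 hcW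
    hδb0 hδb hK0 hε0 (fun j _ => by rw [hAj]) hsmall
  -- §3 the Gram constants decrease
  have hκmono : ∀ j, κ (j + 1) ≤ κ j := fun j => by
    have h : κ (j + 1) ^ 2 ≤ κ j ^ 2 := by
      rw [hκ2, hκ2, pow_succ (8 : ℝ) j, mul_inv]
      have h8 : (0 : ℝ) < ((8 : ℝ) ^ j)⁻¹ := by positivity
      have hk : 0 ≤ k₀ ^ 2 * ((8 : ℝ) ^ j)⁻¹ := by positivity
      nlinarith [hk]
    exact (pow_le_pow_iff_left₀ (hκ _).le (hκ _).le two_ne_zero).1 h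
  -- §4 the data bundles with the budget `NV`
  have hdata : ∀ᶠ L in atTop, ∀ (b M : ℕ) [NeZero L] [NeZero (b * L)] [NeZero M], Mth L b ≤ M →
      TowerVolumeDataTS L M β U μ (klFlowFrameU L M β U μ (nScales β + 1)) (nScales β) (imagTimeWeight β M) t Λ κ aW sW NV ∧
      TowerVolumeDataTS (b * L) M β U μ (klFlowFrameU (b * L) M β U μ (nScales β + 1)) (nScales β) (imagTimeWeight β M) t Λ κ aW sW NV ∧
      TowerCrossData L b M β μ (klFlowFrameU L M β U μ (nScales β + 1)) (klFlowFrameU (b * L) M β U μ (nScales β + 1)) (nScales β) (imagTimeWeight β M)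
        Λ κ aW sW eW' ΛT cW κf (fun j => sE j L) (fun j => cR j L) (fun j => cC j L) (fun j => δ j L) := by
    filter_upwards [hinst] with L hL
    intro b M iL ibL iM hM
    obtain ⟨hZc, hZf, hcovc, hcovf, h0c, h0f, h24c, h24f, hX⟩ := hL b M hM
    -- the profile budget of `towerVolumeDataTS_of_readout` agrees with `NV` away from degree `0`
    have hbud : ∀ j, j ≤ J → (fun m : ℕ => if m = 0 then (0 : ℝ) else imagTimeWeight β M *
        (S₀ j (2 * m) + t * klSrcBudget P Q' U A (j + 1) 1 (2 * m) + t ^ 2 * klSrcBudget P Q' U A (j + 1) 2 (2 * m))) =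
        fun m => imagTimeWeight β M * NV j m := by
      intro j hj
      funext m
      rw [hNV, if_pos hj]
      split_ifs <;> simp
    have hvol : ∀ {V : ℕ} [NeZero V],
        (∀ k, k ≤ nScales β → hubbardEffPartitionFnCT V M β U μ 0 (klFlowFrameU V M β U μ (nScales β + 1)) (klScale klE0 (k + 1)) ≠ 0) →
        (∀ j, j < nScales β → ScaleCovData (klStepCov V M β μ (klFlowFrameU V M β U μ (nScales β + 1)) j) (Λ j) (κ j) (aW j / imagTimeWeight β M) (sW j)) →
        (∀ j, j ≤ nScales β → ∀ (m : ℕ) (q : Fin m) (w : SpaceTimeIdx V M × SectorLeg (sectorCount j)),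
          klWtPinnedSumAt V M β μ (klFlowFrameU V M β U μ (nScales β + 1)) j (r j) m
            (klEffectiveAction V M β U μ (klFlowFrameU V M β U μ (nScales β + 1)) klE0 (j + 1)) q w ≤ S₀ j m) →
        (∀ j, j ≤ nScales β → SourceProfilesAtLev V M (klSrcBudget P Q' U A (j + 1)) β U μ (klFlowFrameU V M β U μ (nScales β + 1)) j (r j) (j + 1)) →
        TowerVolumeDataTS V M β U μ (klFlowFrameU V M β U μ (nScales β + 1)) (nScales β) (imagTimeWeight β M) t Λ κ aW sW NV := by
      intro V _ hZ hcov h0 h24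
      have hv := towerVolumeDataTS_of_readout hβ U μ (klFlowFrameU V M β U μ (nScales β + 1)) (nScales β) ht0.le Λ κ aW sW r hΛr hZ hcov S₀
        (fun j s m => klSrcBudget P Q' U A (j + 1) s m) hS₀0 (fun j s m => hSB (j + 1) s m) h0 h24
      exact ⟨hv.Z, hv.parity, hv.cov, fun j hj => by
        have hp := (hv.profile j hj).zeroDegree
        rw [hbud j hj] at hp
        exact hp⟩
    exact ⟨hvol hZc hcovc h0c h24c, hvol hZf hcovf h0f h24f, hX⟩
  -- §5 the package
  exact towerDataTS_of_lawsH0 β U μ ht0.le ht1 Mth Λ ΛT κ κf aW sW eW' cW cRb cCb δb Aj q NV sE cR cC δ kf cW₀ δb₀ r₀ hΛ hΛmono hΛT hκ hκmono hκfge hκf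
    hkf haW0 hsW heW' hcW1 hcW hcRb0 hcCb0 hδb0 hδb hr₀ hq' hNV0 hAj0 hNVle hS hS' hmis hmis0 hdata
    h0T

end Summit.HubbardSuperconductivity.HubbardSuperconductivity.Theorems.TwoVolumeSource

end
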